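import Mathlib
import Literature.NumberTheory.LFunctions.Zhang2022.TypedSection15AIdentities
import Literature.NumberTheory.LFunctions.Zhang2022.Section15Bcoef
import Literature.NumberTheory.LFunctions.Zhang2022.ToolkitDivisorMajorants
import Literature.NumberTheory.LFunctions.Zhang2022.Section15Eq1523Edge
import Literature.NumberTheory.LFunctions.MontgomeryOffDiagonalTools
import HarnessLib

/-!
# Zhang (2022) §15: the edges u021 ⇒ u023 ⇒ u024 ⇒ (15.11) at the χ-absorbed coefficients `b = χ·b`

Topic `Literature/NumberTheory/LFunctions/Zhang2022` (Landau–Siegel audit tree; verdict-neutral).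
Y. Zhang, *Discrete mean estimates and the Landau–Siegel zero*, arXiv:2211.02515v1 (2022)
[Zhang2022LandauSiegel] — **an unrefereed manuscript under adjudication**; this file PROVES printed
inferences between typed claims of §15 pp. 82–83 (`TypedSection15A.lean`); it does not assert the claims
themselves and says nothing about Theorems 1–2 (ZHANG-L lane, WP15, leaf `h15_17`, the (15.11) cone).

* `step15_u023w_of` — **u023 from u019 + u021** (p. 83, tex L4139, "This yields …"): for every `p ∼ P`,
  `d, k ≥ 1` with `dk < 2P₄`, the `l`-series `Σ_{(l,k)=1}(κ₁∗b)(dl)χ(l)Δ(l/(Dpk))` equals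
  `𝓡₁* Dpk Σ_{d=d₁d₂} κ̃₁(d₁;d₂k)λ₁(dk) Σ_{(l₂,k)=1} b(d₂l₂)χ(l₂)/l₂` up to
  `C·α⁵⁰·τ₅(d)·Dpk` — the regrouping u019 (tree, `step15_u019_chi_holds`) followed by u021 termwise in
  `(d₁, d₂, l₂)`; the weight is the DERIVABLE `τ₅(d) = (τ₃∗τ₂)(d)` (u021's `τ₃(d₁)` times `|b(d₂l₂)| ≪
  τ₂(d₂l₂)`, (15.2)), not the printed `τ₃(d)` of `Typed.Section15A.Step15_u023` (whose error term carries the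
  bound variable `d₁`, flagged by the typer) — the statement is spelled inline, no new `Prop` is defined.
  The range `l₂ < PT⁻²` of u021 covers the whole support of `b` (`Skeleton.bcoef_eq_zero_of_le`).
* `step15_u024_chi_of_u021` — **u024** (p. 83, tex L4147, "Hence …"), the typed node
  `Typed.Section15A.Step15_u024 c′ bChi` BY NAME from `Step15_u021 c′`: the `d`-sum with weights `g̃₃(dk)/d`
  absorbs `Σ_{d≤2P₄} τ₅(d)/d ≪ 𝓛⁴⁵` (`MeanSquareMajorant.sum_tau_div_Icc_le_log_pow`), `|g̃₃| ≤ 1`,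
  `α⁵⁰𝓛⁴⁵ ≤ α³⁰`; the double sum over `d₁, d₂ ≤ 2P₄` is the sum over `d = d₁d₂ ≤ 2P₄` (terms with
  `d₁d₂k ≥ 2P₄` vanish, `g̃₃ = 0` there).
* `eq15_11_chi_of_u024` — **(15.11)** (p. 83, tex L4154, "Inserting this into (15.7) …"), the typed node
  `Typed.Section15A.Eq15_11 c′ bChi` BY NAME from `Step15_u024 c′ bChi`: the `k`-sum of (15.7) with weights
  `μχ(k)/(kφ(k))`, the error `φ(D)⁻¹Σ_k α³⁰Dpk/(kφ(k)) ≤ α³⁰p(D/φ(D))Σ_{k≤2P₄}φ(k)⁻¹ = o(P)`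
  (`D/φ(D) ≤ 2 log 𝓛`, `Σ_{k≤K} φ(k)⁻¹ ≤ 7 + 12 log K`), and the re-indexing "`d, l, m` for `d₂, l₂, d₁`"
  onto `𝔇₁(d,l)` (`Typed.Section15A.calD1`).
* `eq15_11_chi_of_u021` — the composite `Step15_u021 c′ → Eq15_11 c′ bChi`.

Theorems only; 0 definitions; 0 new facts; no kit.

## References

* Y. Zhang, arXiv:2211.02515v1 (2022), §15 pp. 82–83, (15.7)–(15.11), tex L4094–L4160; (15.2) p. 79.
  [cite: Zhang2022LandauSiegel, §15 (15.7)–(15.11)]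
-/

noncomputable section

open Complex Real Finset

namespace Literature.NumberTheory.LFunctions.Zhang2022.Typed.Section15A

open Literature.NumberTheory.LFunctions.Zhang2022.Skeleton
open Literature.NumberTheory.LFunctions.Zhang2022.MeanSquareMajorant (tau)

/-! ## Elementary helpers -/

/-- `𝓛 ≥ 1` for `D ≥ 3` (local copy). [cite: Zhang2022LandauSiegel, §2 (2.1)] -/
private theorem one_le_ell_e {D : ℕ} (hD : 3 ≤ D) : 1 ≤ ell D := by
  have hD' : (3 : ℝ) ≤ D := by exact_mod_cast hD
  have h : (1 : ℝ) < Real.log 3 := by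
    rw [Real.lt_log_iff_exp_lt (by norm_num)]
    exact Real.exp_one_lt_d9.trans (by norm_num)
  exact le_trans h.le (Real.log_le_log (by norm_num) hD')

/-- `τ₅ = τ₃ ∗ τ₂` pointwise: `Σ_{d = d₁d₂} τ₃(d₁)τ₂(d₂) = τ₅(d)`. [folklore] -/
private theorem sum_antidiagonal_tau_three_two (d : ℕ) :
    ∑ dd ∈ d.divisorsAntidiagonal, tau 3 dd.1 * tau 2 dd.2 = tau 5 d := by
  have h : tau 5 = tau 3 * tau 2 := by
    rw [MeanSquareMajorant.tau, MeanSquareMajorant.tau, MeanSquareMajorant.tau, ← pow_add]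
  rw [h, ArithmeticFunction.mul_apply]

/-- `τ_j(n) ≥ 0`. [folklore] -/
private theorem tau_nonneg' (j n : ℕ) : 0 ≤ tau j n := by
  induction j generalizing n with
  | zero =>
    rw [MeanSquareMajorant.tau, pow_zero, ArithmeticFunction.one_apply]
    split_ifs <;> norm_num
  | succ j ih =>
    rw [MeanSquareMajorant.tau, pow_succ, ArithmeticFunction.mul_apply]
    refine Finset.sum_nonneg fun x _ => mul_nonneg ?_ ?_
    · exact ih x.1
    · rw [ArithmeticFunction.natCoe_apply, ArithmeticFunction.zeta_apply]
      split_ifs <;> norm_num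

/-- `χ·b` vanishes off `[1, PT⁻²)`: for `n` with `PT⁻² ≤ n` (`𝓛 ≥ 3`). [cite: Zhang2022LandauSiegel, §15 (15.2)] -/
private theorem bChi_eq_zero_of_le {D : ℕ} (χ : DirichletCharacter ℂ D) (hℓ : 3 ≤ ell D) {n : ℕ}
    (hn : bigP D / bigT D ^ 2 ≤ n) : bChi D χ n = 0 := by
  simp only [bChi, bchi, bcoef_eq_zero_of_le hℓ hn, mul_zero]

/-- `|χ·b(n)| ≤ C_b τ₂(n)` with `C_b = (1+|ι₂|)(|ι₃|+|ι₄|)` (`𝓛 ≥ 2`). [cite: Zhang2022LandauSiegel, §15 (15.2)] -/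
private theorem norm_bChi_le {D : ℕ} (χ : DirichletCharacter ℂ D) (hℓ : 2 ≤ Real.log D) (n : ℕ) :
    ‖bChi D χ n‖ ≤ (1 + ‖iota2‖) * (‖iota3‖ + ‖iota4‖) * tau 2 n := by
  simp only [bChi, bchi]
  rw [norm_mul]
  calc ‖χ (n : ZMod D)‖ * ‖bcoef D n‖ ≤ 1 * ‖bcoef D n‖ := by
        gcongr; exact DirichletCharacter.norm_le_one _ _
    _ = ‖bcoef D n‖ := one_mul _
    _ ≤ _ := norm_bcoef_le hℓ n

/-- `Σ_{n≤Y} τ₂(mn)/n ≤ τ₂(m)(1 + log Y)²`. [folklore] -/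
private theorem sum_tau_two_mul_div_le (m Y : ℕ) :
    ∑ n ∈ Finset.Icc 1 Y, tau 2 (m * n) / n ≤ tau 2 m * (1 + Real.log Y) ^ 2 := by
  calc ∑ n ∈ Finset.Icc 1 Y, tau 2 (m * n) / n ≤ ∑ n ∈ Finset.Icc 1 Y, tau 2 m * (tau 2 n / n) := by
        refine Finset.sum_le_sum fun n hn => ?_
        rw [← mul_div_assoc]
        exact div_le_div_of_nonneg_right (MeanSquareMajorant.tau_mul_le 2 m n) (Nat.cast_nonneg n)
    _ = tau 2 m * ∑ n ∈ Finset.Icc 1 Y, tau 2 n / n := by rw [Finset.mul_sum]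
    _ ≤ tau 2 m * (1 + Real.log Y) ^ 2 :=
        mul_le_mul_of_nonneg_left (MeanSquareMajorant.sum_tau_div_Icc_le_log_pow 2 Y) (tau_nonneg' 2 m)


/-- `3 ≤ 𝓛` once `D ≥ ⌈e³⌉`. [cite: Zhang2022LandauSiegel, §2 (2.1)] -/
private theorem three_le_ell_of_le {D : ℕ} (hD : ⌈Real.exp 3⌉₊ ≤ D) : 3 ≤ ell D := by
  have h : Real.exp 3 ≤ D := le_trans (Nat.le_ceil _) (by exact_mod_cast hD)
  exact (Real.le_log_iff_exp_le (lt_of_lt_of_le (Real.exp_pos _) h)).mpr h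

/-- `α = π/𝓛⁹ ≥ 0` and `α^{50}·𝓛^{18} ≤ π^{50}` (`𝓛 ≥ 1`). [cite: Zhang2022LandauSiegel, §2 (2.10)] -/
private theorem alpha_facts {D : ℕ} (hD : 3 ≤ D) :
    0 ≤ alpha D ∧ alpha D ^ 50 * ell D ^ 18 ≤ Real.pi ^ 50 ∧ alpha D ≤ Real.pi := by
  have hℓ1 : 1 ≤ ell D := one_le_ell_e hD
  have hα : alpha D = Real.pi / ell D ^ 9 := by rw [alpha, bigP, Real.log_exp]
  have hℓ9 : 1 ≤ ell D ^ 9 := one_le_pow₀ hℓ1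
  refine ⟨by rw [hα]; positivity, ?_, ?_⟩
  · rw [hα, div_pow, ← pow_mul, div_mul_eq_mul_div, div_le_iff₀ (by positivity)]
    have : ell D ^ 18 ≤ ell D ^ (9 * 50) := pow_le_pow_right₀ hℓ1 (by norm_num)
    exact mul_le_mul_of_nonneg_left this (by positivity)
  · rw [hα]; exact div_le_self Real.pi_pos.le hℓ9

/-- **u023 from u019 + u021, with the derivable weight `τ₅(d)`** (p. 83, tex L4139: "This yields
`Σ_{(l,k)=1}(κ₁∗b)(dl)χ(l)Δ(l/(Dpk)) = 𝓡₁*Dpk Σ_{d=d₁d₂} κ̃₁(d₁;d₂k)λ₁(dk) Σ_{(l₂,k)=1} b(d₂l₂)χ(l₂)/l₂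
+ O(…)`", at `b = χ·b`): for all large `D`, under (A), for `p ∼ P`, `d, k ≥ 1`, `dk < 2P₄`, the
difference is `≤ C·α⁵⁰·τ₅(d)·Dpk`. Route: the regrouping u019 (`step15_u019_chi_holds`), then u021
(hypothesis, the typed `Step15_u021 c′`) for every `(d₁, d₂, l₂)` with `b(d₂l₂) ≠ 0` — such `l₂` have
`d₂l₂ < PT⁻²` (`Skeleton.bcoef_eq_zero_of_le`), so u021's range applies and the `l₂`-series are finite
sums; `|b| ≤ C_bτ₂` ((15.2), `Skeleton.norm_bcoef_le`), `Σ_{l₂≤P}τ₂(d₂l₂)/l₂ ≤ τ₂(d₂)(1+𝓛⁹)²`,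
`Σ_{d=d₁d₂}τ₃(d₁)τ₂(d₂) = τ₅(d)`, `α¹⁰⁰𝓛¹⁸ ≤ π⁵⁰α⁵⁰`. (The typed `Step15_u023`, error `τ₃(d)`, is not
claimed.) [cite: Zhang2022LandauSiegel, §15 p. 83, tex L4139] -/
theorem step15_u023w_of (c' : ℝ) (h21 : Step15_u021 c') :
    ∃ C : ℝ, ForAllLarge fun D _ χ => AssumptionA D χ → ∀ p ∈ primeWindow D, ∀ d k : ℕ,
      0 < d → 0 < k → ((d * k : ℕ) : ℝ) < 2 * P4 D →
        ‖(∑' l : ℕ, if Nat.Coprime l k then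
              kappaStar1 c' D (bChi D χ) (d * l) * χ (l : ZMod D) *
                DeltaW D ((l : ℝ) / ((D : ℝ) * p * k))
            else 0) -
            calR1star c' χ * ((D : ℂ) * p * k) *
              ∑ dd ∈ d.divisorsAntidiagonal,
                kappaTilde1 c' χ dd.1 (dd.2 * k) 1 * lam1 c' χ (d * k) 1 *
                  ∑' l₂ : ℕ, (if Nat.Coprime l₂ k then
                    bChi D χ (dd.2 * l₂) * χ (l₂ : ZMod D) / (l₂ : ℂ) else 0)‖
          ≤ C * alpha D ^ 50 * tau 5 d * ((D : ℝ) * p * k) := by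
  obtain ⟨C₂₁, D₁, h21'⟩ := h21
  set Cb : ℝ := (1 + ‖iota2‖) * (‖iota3‖ + ‖iota4‖) with hCb
  have hCb0 : 0 ≤ Cb := by positivity
  refine ⟨4 * |C₂₁| * Cb * Real.pi ^ 50, max D₁ ⌈Real.exp 3⌉₊,
    fun D _ χ hD hq hp hA p hpw d k hd hk hdk => ?_⟩
  have hD₁ : D₁ ≤ D := le_trans (le_max_left _ _) hD
  have hℓ3 : 3 ≤ ell D := three_le_ell_of_le (le_trans (le_max_right _ _) hD)
  have hℓ2 : 2 ≤ Real.log D := by have := hℓ3; rw [ell] at this; linarith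
  have hD3 : 3 ≤ D := three_le_of_one_lt_two_mul_P4 (lt_of_le_of_lt
    (by exact_mod_cast Nat.one_le_iff_ne_zero.mpr (Nat.mul_ne_zero hd.ne' hk.ne')) hdk)
  obtain ⟨hα0, hα50, -⟩ := alpha_facts hD3
  have hℓ1 : 1 ≤ ell D := one_le_ell_e hD3
  have hp0 : 0 < p := (Finset.mem_filter.mp hpw).2.pos
  have hD0 : 0 < D := by omega
  set R : ℝ := (D : ℝ) * p * k with hR
  have hR0 : 0 < R := by rw [hR]; positivity
  -- the cut-off of the `l₂`-sums
  set N : ℕ := ⌊bigP D / bigT D ^ 2⌋₊ with hN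
  have hPT0 : 0 ≤ bigP D / bigT D ^ 2 := by unfold bigP bigT; positivity
  have hsupp : ∀ (m l₂ : ℕ), 0 < m → l₂ ∉ Finset.Icc 1 N → bChi D χ (m * l₂) = 0 := by
    intro m l₂ hm hl₂
    rw [Finset.mem_Icc, not_and_or, not_le, not_le] at hl₂
    rcases hl₂ with h0 | hN'
    · have : l₂ = 0 := by omega
      subst this
      simp [bChi, bchi, bcoef]
    · refine bChi_eq_zero_of_le χ hℓ3 ?_
      have h1 : bigP D / bigT D ^ 2 < l₂ := (Nat.floor_lt hPT0).mp hN'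
      have h2 : (l₂ : ℝ) ≤ ((m * l₂ : ℕ) : ℝ) := by
        exact_mod_cast Nat.le_mul_of_pos_left l₂ hm
      exact h1.le.trans h2
  -- Step 1: u019
  rw [step15_u019_chi_holds c' D χ p d k hpw hd hk hdk]
  -- abbreviations
  set S : ℕ × ℕ → ℕ → ℂ := fun dd l₂ =>
    ∑' l₁ : ℕ, (if Nat.Coprime l₁ (dd.2 * k) then
      kappa1 c' D (dd.1 * l₁) * χ (l₁ : ZMod D) * DeltaW D (((l₁ * l₂ : ℕ) : ℝ) / ((D : ℝ) * p * k))
      else 0) with hS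
  set M : ℕ × ℕ → ℕ → ℂ := fun dd l₂ =>
    calR1star c' χ * ((((D : ℝ) * p * k / l₂ : ℝ)) : ℂ) *
      kappaTilde1 c' χ dd.1 (dd.2 * k) 1 * lam1 c' χ (dd.1 * dd.2 * k) 1 with hM
  -- Step 2: the `l₂`-series are finite sums
  have hF : ∀ dd ∈ d.divisorsAntidiagonal,
      (∑' l₂ : ℕ, if Nat.Coprime l₂ k then bChi D χ (dd.2 * l₂) * χ (l₂ : ZMod D) * S dd l₂ else 0) =
        ∑ l₂ ∈ Finset.Icc 1 N,
          if Nat.Coprime l₂ k then bChi D χ (dd.2 * l₂) * χ (l₂ : ZMod D) * S dd l₂ else 0 := by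
    intro dd hdd
    have hd2 : 0 < dd.2 := Nat.pos_of_mem_divisors (Nat.snd_mem_divisors_of_mem_antidiagonal hdd)
    refine tsum_eq_sum fun l₂ hl₂ => ?_
    rw [hsupp dd.2 l₂ hd2 hl₂]; simp
  have hG : ∀ dd ∈ d.divisorsAntidiagonal,
      (∑' l₂ : ℕ, if Nat.Coprime l₂ k then bChi D χ (dd.2 * l₂) * χ (l₂ : ZMod D) / (l₂ : ℂ) else 0) =
        ∑ l₂ ∈ Finset.Icc 1 N,
          if Nat.Coprime l₂ k then bChi D χ (dd.2 * l₂) * χ (l₂ : ZMod D) / (l₂ : ℂ) else 0 := by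
    intro dd hdd
    have hd2 : 0 < dd.2 := Nat.pos_of_mem_divisors (Nat.snd_mem_divisors_of_mem_antidiagonal hdd)
    refine tsum_eq_sum fun l₂ hl₂ => ?_
    rw [hsupp dd.2 l₂ hd2 hl₂]; simp
  -- Step 3: rewrite the difference as a double finite sum of `bχ·(S − M)`
  have hdiff :
      (∑ dd ∈ d.divisorsAntidiagonal,
          ∑' l₂ : ℕ, if Nat.Coprime l₂ k then bChi D χ (dd.2 * l₂) * χ (l₂ : ZMod D) * S dd l₂ else 0) -
        calR1star c' χ * ((D : ℂ) * p * k) *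
          ∑ dd ∈ d.divisorsAntidiagonal,
            kappaTilde1 c' χ dd.1 (dd.2 * k) 1 * lam1 c' χ (d * k) 1 *
              ∑' l₂ : ℕ, (if Nat.Coprime l₂ k then
                bChi D χ (dd.2 * l₂) * χ (l₂ : ZMod D) / (l₂ : ℂ) else 0) =
      ∑ dd ∈ d.divisorsAntidiagonal, ∑ l₂ ∈ Finset.Icc 1 N,
        if Nat.Coprime l₂ k then bChi D χ (dd.2 * l₂) * χ (l₂ : ZMod D) * (S dd l₂ - M dd l₂) else 0 := by
    rw [Finset.mul_sum, ← Finset.sum_sub_distrib]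
    refine Finset.sum_congr rfl fun dd hdd => ?_
    have hdd' : dd.1 * dd.2 = d := (Nat.mem_divisorsAntidiagonal.mp hdd).1
    rw [hF dd hdd, hG dd hdd, Finset.mul_sum, Finset.mul_sum, ← Finset.sum_sub_distrib]
    refine Finset.sum_congr rfl fun l₂ hl₂ => ?_
    have hl₂0 : (l₂ : ℂ) ≠ 0 := by
      have : 0 < l₂ := (Finset.mem_Icc.mp hl₂).1; exact_mod_cast this.ne'
    split_ifs with hc
    · simp only [hM, ← hdd']
      push_cast
      field_simp
    · simp
  rw [hdiff]
  -- Step 4: the termwise bound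
  have hterm : ∀ dd ∈ d.divisorsAntidiagonal, ∀ l₂ ∈ Finset.Icc 1 N,
      ‖(if Nat.Coprime l₂ k then bChi D χ (dd.2 * l₂) * χ (l₂ : ZMod D) * (S dd l₂ - M dd l₂) else 0)‖
        ≤ |C₂₁| * Cb * alpha D ^ 100 * R * (tau 3 dd.1 * (tau 2 (dd.2 * l₂) / l₂)) := by
    intro dd hdd l₂ hl₂
    have hdd' : dd.1 * dd.2 = d := (Nat.mem_divisorsAntidiagonal.mp hdd).1
    have hd1 : 0 < dd.1 := Nat.pos_of_mem_divisors (Nat.fst_mem_divisors_of_mem_antidiagonal hdd)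
    have hd2 : 0 < dd.2 := Nat.pos_of_mem_divisors (Nat.snd_mem_divisors_of_mem_antidiagonal hdd)
    have hl₂ : 0 < l₂ := (Finset.mem_Icc.mp hl₂).1
    have hK0 : 0 ≤ |C₂₁| * Cb * alpha D ^ 100 * R :=
      mul_nonneg (mul_nonneg (mul_nonneg (abs_nonneg _) hCb0) (pow_nonneg hα0 _)) hR0.le
    have hrhs0 : 0 ≤ |C₂₁| * Cb * alpha D ^ 100 * R * (tau 3 dd.1 * (tau 2 (dd.2 * l₂) / l₂)) :=
      mul_nonneg hK0 (mul_nonneg (tau_nonneg' _ _) (div_nonneg (tau_nonneg' _ _) (Nat.cast_nonneg _)))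
    split_ifs with hc
    swap
    · simpa using hrhs0
    by_cases hlt : ((dd.2 * l₂ : ℕ) : ℝ) < bigP D / bigT D ^ 2
    · -- u021 applies
      have hl₂T : (l₂ : ℝ) < bigP D / bigT D ^ 2 := by
        refine lt_of_le_of_lt ?_ hlt
        exact_mod_cast Nat.le_mul_of_pos_left l₂ hd2
      have hddk : ((dd.1 * dd.2 * k : ℕ) : ℝ) < 2 * P4 D := by rw [hdd']; exact hdk
      have h21D := h21' D χ hD₁ hq hp hA p hpw dd.1 dd.2 k l₂ hd1 hd2 hk hl₂ hddk hl₂T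
      have hb := norm_bChi_le χ hℓ2 (dd.2 * l₂)
      rw [norm_mul, norm_mul]
      have hχ1 : ‖χ (l₂ : ZMod D)‖ ≤ 1 := DirichletCharacter.norm_le_one _ _
      have hSM : ‖S dd l₂ - M dd l₂‖ ≤ C₂₁ * alpha D ^ 100 * tau 3 dd.1 * (R / l₂) := by
        simpa only [hS, hM, hR] using h21D
      have hW0 : 0 ≤ alpha D ^ 100 * tau 3 dd.1 * (R / l₂) :=
        mul_nonneg (mul_nonneg (pow_nonneg hα0 _) (tau_nonneg' _ _)) (div_nonneg hR0.le (Nat.cast_nonneg _))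
      have hSM' : ‖S dd l₂ - M dd l₂‖ ≤ |C₂₁| * alpha D ^ 100 * tau 3 dd.1 * (R / l₂) := by
        refine hSM.trans ?_
        calc C₂₁ * alpha D ^ 100 * tau 3 dd.1 * (R / l₂)
            = C₂₁ * (alpha D ^ 100 * tau 3 dd.1 * (R / l₂)) := by ring
          _ ≤ |C₂₁| * (alpha D ^ 100 * tau 3 dd.1 * (R / l₂)) :=
              mul_le_mul_of_nonneg_right (le_abs_self _) hW0
          _ = _ := by ring
      have hb0 : 0 ≤ Cb * tau 2 (dd.2 * l₂) := mul_nonneg hCb0 (tau_nonneg' _ _)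
      have h12 : ‖bChi D χ (dd.2 * l₂)‖ * ‖χ (l₂ : ZMod D)‖ ≤ Cb * tau 2 (dd.2 * l₂) * 1 :=
        mul_le_mul hb hχ1 (norm_nonneg _) hb0
      calc ‖bChi D χ (dd.2 * l₂)‖ * ‖χ (l₂ : ZMod D)‖ * ‖S dd l₂ - M dd l₂‖
          ≤ (Cb * tau 2 (dd.2 * l₂) * 1) * (|C₂₁| * alpha D ^ 100 * tau 3 dd.1 * (R / l₂)) :=
            mul_le_mul h12 hSM' (norm_nonneg _) (by rw [mul_one]; exact hb0)
      _ = |C₂₁| * Cb * alpha D ^ 100 * R * (tau 3 dd.1 * (tau 2 (dd.2 * l₂) / l₂)) := by ring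
    · -- outside the support of `b`
      rw [not_lt] at hlt
      rw [bChi_eq_zero_of_le χ hℓ3 hlt, zero_mul, zero_mul, norm_zero]
      exact hrhs0
  -- Step 5: summing the bound
  have hlogN : (1 + Real.log N) ^ 2 ≤ 4 * ell D ^ 18 := by
    have hN1 : Real.log N ≤ ell D ^ 9 := by
      rcases Nat.eq_zero_or_pos N with h0 | hN0
      · rw [h0, Nat.cast_zero, Real.log_zero]; positivity
      · have hN' : (N : ℝ) ≤ bigP D := by
          calc (N : ℝ) ≤ bigP D / bigT D ^ 2 := Nat.floor_le hPT0
            _ ≤ bigP D := by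
                refine div_le_self (by unfold bigP; positivity) ?_
                exact one_le_pow₀ (by unfold bigT; exact Real.one_le_exp (by positivity))
        calc Real.log N ≤ Real.log (bigP D) :=
              Real.log_le_log (by exact_mod_cast hN0) hN'
          _ = ell D ^ 9 := by rw [bigP, Real.log_exp]
    have h19 : 1 ≤ ell D ^ 9 := one_le_pow₀ hℓ1
    nlinarith [Real.log_natCast_nonneg N]
  have hK0' : 0 ≤ |C₂₁| * Cb * alpha D ^ 100 * R :=
    mul_nonneg (mul_nonneg (mul_nonneg (abs_nonneg _) hCb0) (pow_nonneg hα0 _)) hR0.le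
  calc ‖∑ dd ∈ d.divisorsAntidiagonal, ∑ l₂ ∈ Finset.Icc 1 N,
          (if Nat.Coprime l₂ k then bChi D χ (dd.2 * l₂) * χ (l₂ : ZMod D) * (S dd l₂ - M dd l₂)
            else 0)‖
      ≤ ∑ dd ∈ d.divisorsAntidiagonal, ∑ l₂ ∈ Finset.Icc 1 N,
          ‖(if Nat.Coprime l₂ k then bChi D χ (dd.2 * l₂) * χ (l₂ : ZMod D) * (S dd l₂ - M dd l₂)
            else 0)‖ := (norm_sum_le _ _).trans (Finset.sum_le_sum fun dd _ => norm_sum_le _ _)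
    _ ≤ ∑ dd ∈ d.divisorsAntidiagonal, ∑ l₂ ∈ Finset.Icc 1 N,
          |C₂₁| * Cb * alpha D ^ 100 * R * (tau 3 dd.1 * (tau 2 (dd.2 * l₂) / l₂)) :=
        Finset.sum_le_sum fun dd hdd => Finset.sum_le_sum fun l₂ hl₂ => hterm dd hdd l₂ hl₂
    _ = |C₂₁| * Cb * alpha D ^ 100 * R *
          ∑ dd ∈ d.divisorsAntidiagonal, tau 3 dd.1 * ∑ l₂ ∈ Finset.Icc 1 N, tau 2 (dd.2 * l₂) / l₂ := by
        rw [Finset.mul_sum]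
        refine Finset.sum_congr rfl fun dd _ => ?_
        rw [Finset.mul_sum, Finset.mul_sum]
    _ ≤ |C₂₁| * Cb * alpha D ^ 100 * R *
          ∑ dd ∈ d.divisorsAntidiagonal, tau 3 dd.1 * (tau 2 dd.2 * (1 + Real.log N) ^ 2) :=
        mul_le_mul_of_nonneg_left (Finset.sum_le_sum fun dd _ =>
          mul_le_mul_of_nonneg_left (sum_tau_two_mul_div_le dd.2 N) (tau_nonneg' 3 _)) hK0'
    _ = |C₂₁| * Cb * alpha D ^ 100 * R * (1 + Real.log N) ^ 2 *
          ∑ dd ∈ d.divisorsAntidiagonal, tau 3 dd.1 * tau 2 dd.2 := by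
        rw [Finset.mul_sum, Finset.mul_sum]
        refine Finset.sum_congr rfl fun dd _ => ?_
        ring
    _ = |C₂₁| * Cb * alpha D ^ 100 * R * (1 + Real.log N) ^ 2 * tau 5 d := by
        rw [sum_antidiagonal_tau_three_two]
    _ ≤ |C₂₁| * Cb * alpha D ^ 100 * R * (4 * ell D ^ 18) * tau 5 d :=
        mul_le_mul_of_nonneg_right (mul_le_mul_of_nonneg_left hlogN hK0') (tau_nonneg' 5 d)
    _ = 4 * |C₂₁| * Cb * (alpha D ^ 50 * ell D ^ 18) * alpha D ^ 50 * tau 5 d * R := by ring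
    _ ≤ 4 * |C₂₁| * Cb * Real.pi ^ 50 * alpha D ^ 50 * tau 5 d * R := by
        have h4 : 0 ≤ 4 * |C₂₁| * Cb := mul_nonneg (mul_nonneg (by norm_num) (abs_nonneg _)) hCb0
        have h5 : 4 * |C₂₁| * Cb * (alpha D ^ 50 * ell D ^ 18) ≤ 4 * |C₂₁| * Cb * Real.pi ^ 50 :=
          mul_le_mul_of_nonneg_left hα50 h4
        exact mul_le_mul_of_nonneg_right (mul_le_mul_of_nonneg_right
          (mul_le_mul_of_nonneg_right h5 (pow_nonneg hα0 _)) (tau_nonneg' 5 d)) hR0.le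
    _ = 4 * |C₂₁| * Cb * Real.pi ^ 50 * alpha D ^ 50 * tau 5 d * ((D : ℝ) * p * k) := by rw [hR]


/-! ## u024 from u021 -/

/-- `g̃₃(n) = 0` for `n ≥ 2P₄` when `n ≥ 1` (`g*(P₄/n) = 0` once `P₄/n ≤ 1/2`; the tree's
`gtilde3_eq_zero` is the strict case). [cite: Zhang2022LandauSiegel, §15 p. 81] -/
private theorem gtilde3_eq_zero_of_le (c' : ℝ) {D n : ℕ} (hn0 : 0 < n) (hn : 2 * P4 D ≤ n) :
    gtilde3 c' D n = 0 := by
  have hn' : (0 : ℝ) < n := by exact_mod_cast hn0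
  have hg : gstar D (P4 D / n) = 0 := by
    rw [gstar, if_neg]
    rw [not_lt, div_le_iff₀ hn']
    linarith
  rw [gtilde3, hg, Complex.ofReal_zero, mul_zero]

/-- Re-indexing a double sum over `d₁, d₂ ≤ N` whose terms vanish for `d₁d₂ > N` as a sum over
`d = d₁d₂ ≤ N` and the factorisations `d = d₁d₂`. [folklore] -/
private theorem sum_Icc_sum_Icc_eq_sum_divisorsAntidiagonal (N : ℕ) (f : ℕ × ℕ → ℂ)
    (hf : ∀ dd ∈ Finset.Icc 1 N ×ˢ Finset.Icc 1 N, N < dd.1 * dd.2 → f dd = 0) :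
    ∑ d₁ ∈ Finset.Icc 1 N, ∑ d₂ ∈ Finset.Icc 1 N, f (d₁, d₂) =
      ∑ d ∈ Finset.Icc 1 N, ∑ dd ∈ d.divisorsAntidiagonal, f dd := by
  classical
  rw [← Finset.sum_product (s := Finset.Icc 1 N) (t := Finset.Icc 1 N) (f := fun dd => f dd)]
  set T := (Finset.Icc 1 N ×ˢ Finset.Icc 1 N).filter (fun dd : ℕ × ℕ => dd.1 * dd.2 ≤ N) with hT
  have h1 : ∑ dd ∈ Finset.Icc 1 N ×ˢ Finset.Icc 1 N, f dd = ∑ dd ∈ T, f dd := by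
    rw [hT, Finset.sum_filter]
    refine Finset.sum_congr rfl fun dd hdd => ?_
    split_ifs with h
    · rfl
    · exact hf dd hdd (not_le.mp h)
  rw [h1]
  have hmaps : ∀ dd ∈ T, dd.1 * dd.2 ∈ Finset.Icc 1 N := by
    intro dd hdd
    rw [hT, Finset.mem_filter, Finset.mem_product, Finset.mem_Icc, Finset.mem_Icc] at hdd
    rw [Finset.mem_Icc]
    exact ⟨Nat.one_le_iff_ne_zero.mpr (Nat.mul_ne_zero (by omega) (by omega)), hdd.2⟩
  rw [← Finset.sum_fiberwise_of_maps_to hmaps]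
  refine Finset.sum_congr rfl fun d hd => Finset.sum_congr ?_ fun _ _ => rfl
  rw [Finset.mem_Icc] at hd
  ext dd
  rw [Finset.mem_filter, hT, Finset.mem_filter, Finset.mem_product, Finset.mem_Icc, Finset.mem_Icc,
    Nat.mem_divisorsAntidiagonal]
  constructor
  · rintro ⟨⟨-, -⟩, h⟩
    exact ⟨h, by omega⟩
  · rintro ⟨h, -⟩
    have h1 : 1 ≤ dd.1 := Nat.one_le_iff_ne_zero.mpr fun h0 => by rw [h0, zero_mul] at h; omega
    have h2 : 1 ≤ dd.2 := Nat.one_le_iff_ne_zero.mpr fun h0 => by rw [h0, mul_zero] at h; omega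
    refine ⟨⟨⟨⟨h1, ?_⟩, ⟨h2, ?_⟩⟩, by omega⟩, h⟩
    · calc dd.1 ≤ dd.1 * dd.2 := Nat.le_mul_of_pos_right _ (by omega)
        _ ≤ N := by omega
    · calc dd.2 ≤ dd.1 * dd.2 := Nat.le_mul_of_pos_left _ (by omega)
        _ ≤ N := by omega

/-- **u024 at `b = χ·b` from u021** (p. 83, tex L4147: "Hence `Σ_d g̃₃(dk)/d Σ_{(l,k)=1}(κ₁∗b)(dl)χ(l)Δ(l/(Dpk))
= 𝓡₁*Dpk Σ_{d₁}Σ_{d₂} g̃₃(d₁d₂k)/(d₁d₂)·κ̃₁(d₁;d₂k)λ₁(d₁d₂k) Σ_{(l₂,k)=1} b(d₂l₂)χ(l₂)/l₂ + O(α³⁰Dpk)`"):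
the typed node `Typed.Section15A.Step15_u024 c′ bChi` from `Step15_u021 c′`. Route: u023 with weight
`τ₅(d)` (`step15_u023w_of`) summed against `|g̃₃(dk)|/d ≤ 1/d`: `Σ_{d≤2P₄} τ₅(d)/d ≤ (1 + log 2P₄)⁵ ≤ 32𝓛⁴⁵`
(`2P₄ ≤ P`), `α²⁰𝓛⁴⁵ ≤ π²⁰`; the terms with `dk ≥ 2P₄` vanish (`g̃₃(dk) = 0`), and the double sum over
`d₁, d₂ ≤ 2P₄` is the sum over `d = d₁d₂ ≤ 2P₄`. [cite: Zhang2022LandauSiegel, §15 p. 83, tex L4147] -/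
theorem step15_u024_chi_of_u021 (c' : ℝ) (h21 : Step15_u021 c') : Step15_u024 c' bChi := by
  obtain ⟨CA, DA, hA'⟩ := step15_u023w_of c' h21
  obtain ⟨DP, hDP⟩ := Typed.Sec14.exists_two_mul_P4_le_bigP
  refine ⟨32 * Real.pi ^ 20 * |CA|, max DA (max DP 3), fun D _ χ hD hq hp hA p hpw k hk => ?_⟩
  have hDA : DA ≤ D := le_trans (le_max_left _ _) hD
  have hDP' : DP ≤ D := le_trans (le_trans (le_max_left _ _) (le_max_right _ _)) hD
  have hD3 : 3 ≤ D := le_trans (le_trans (le_max_right _ _) (le_max_right _ _)) hD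
  obtain ⟨hα0, -, hαπ⟩ := alpha_facts hD3
  have hℓ1 : 1 ≤ ell D := one_le_ell_e hD3
  have hℓ0 : 0 < ell D := by linarith
  have hp0 : 0 < p := (Finset.mem_filter.mp hpw).2.pos
  have hD0 : 0 < D := by omega
  have hR0 : (0 : ℝ) < (D : ℝ) * p * k := by positivity
  have hA'' := hA' D χ hDA hq hp hA p hpw
  set Q : ℕ := ⌊2 * P4 D⌋₊ with hQ
  have hP4 : 0 < P4 D := by
    rw [P4, bigP, bigT, t0]; positivity
  -- abbreviations
  set L : ℕ → ℂ := fun d => ∑' l : ℕ, if Nat.Coprime l k then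
      kappaStar1 c' D (bChi D χ) (d * l) * χ (l : ZMod D) * DeltaW D ((l : ℝ) / ((D : ℝ) * p * k))
    else 0 with hL
  set G : ℕ → ℂ := fun d₂ => ∑' l₂ : ℕ, (if Nat.Coprime l₂ k then
      bChi D χ (d₂ * l₂) * χ (l₂ : ZMod D) / (l₂ : ℂ) else 0) with hG
  set main : ℕ → ℂ := fun d => calR1star c' χ * ((D : ℂ) * p * k) *
      ∑ dd ∈ d.divisorsAntidiagonal, kappaTilde1 c' χ dd.1 (dd.2 * k) 1 * lam1 c' χ (d * k) 1 * G dd.2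
    with hmain
  -- Step 1: the double sum is the `d = d₁d₂` sum
  have hreidx : calR1star c' χ * ((D : ℂ) * p * k) *
        ∑ d₁ ∈ Finset.Icc 1 Q, ∑ d₂ ∈ Finset.Icc 1 Q,
          gtilde3 c' D ((d₁ * d₂ * k : ℕ) : ℝ) / ((d₁ : ℂ) * d₂) *
            kappaTilde1 c' χ d₁ (d₂ * k) 1 * lam1 c' χ (d₁ * d₂ * k) 1 * G d₂ =
      ∑ d ∈ Finset.Icc 1 Q, gtilde3 c' D ((d * k : ℕ) : ℝ) / (d : ℂ) * main d := by
    rw [sum_Icc_sum_Icc_eq_sum_divisorsAntidiagonal Q (fun dd =>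
        gtilde3 c' D ((dd.1 * dd.2 * k : ℕ) : ℝ) / ((dd.1 : ℂ) * dd.2) *
          kappaTilde1 c' χ dd.1 (dd.2 * k) 1 * lam1 c' χ (dd.1 * dd.2 * k) 1 * G dd.2)]
    · rw [Finset.mul_sum]
      refine Finset.sum_congr rfl fun d hd => ?_
      simp only [hmain]
      rw [Finset.mul_sum, Finset.mul_sum, Finset.mul_sum]
      refine Finset.sum_congr rfl fun dd hdd => ?_
      have hdd' : dd.1 * dd.2 = d := (Nat.mem_divisorsAntidiagonal.mp hdd).1
      rw [← hdd']
      push_cast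
      ring
    · intro dd hdd hlt
      have hQ1 : 2 * P4 D < ((dd.1 * dd.2 * k : ℕ) : ℝ) := by
        have h1 : Q + 1 ≤ dd.1 * dd.2 * k := by
          calc Q + 1 ≤ dd.1 * dd.2 := hlt
            _ ≤ dd.1 * dd.2 * k := Nat.le_mul_of_pos_right _ hk
        have h2 : 2 * P4 D < (Q : ℝ) + 1 := Nat.lt_floor_add_one _
        calc 2 * P4 D < (Q : ℝ) + 1 := h2
          _ ≤ ((dd.1 * dd.2 * k : ℕ) : ℝ) := by exact_mod_cast h1
      rw [gtilde3_eq_zero c' hQ1]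
      simp
  rw [hreidx, ← Finset.sum_sub_distrib]
  -- Step 2: termwise
  have hterm : ∀ d ∈ Finset.Icc 1 Q,
      ‖gtilde3 c' D ((d * k : ℕ) : ℝ) / (d : ℂ) * L d - gtilde3 c' D ((d * k : ℕ) : ℝ) / (d : ℂ) * main d‖
        ≤ |CA| * alpha D ^ 50 * ((D : ℝ) * p * k) * (tau 5 d / d) := by
    intro d hd
    have hd1 : 1 ≤ d := (Finset.mem_Icc.mp hd).1
    have hd0 : 0 < d := hd1
    have hrhs0 : 0 ≤ |CA| * alpha D ^ 50 * ((D : ℝ) * p * k) * (tau 5 d / d) :=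
      mul_nonneg (mul_nonneg (mul_nonneg (abs_nonneg _) (pow_nonneg hα0 _)) hR0.le)
        (div_nonneg (tau_nonneg' _ _) (Nat.cast_nonneg _))
    rw [← mul_sub, norm_mul]
    by_cases hdk : ((d * k : ℕ) : ℝ) < 2 * P4 D
    · have h23 := hA'' d k hd0 hk hdk
      have h23' : ‖L d - main d‖ ≤ |CA| * alpha D ^ 50 * tau 5 d * ((D : ℝ) * p * k) := by
        have h23'' : ‖L d - main d‖ ≤ CA * alpha D ^ 50 * tau 5 d * ((D : ℝ) * p * k) := by
          simpa only [hL, hmain, hG] using h23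
        refine h23''.trans ?_
        have h0 : 0 ≤ alpha D ^ 50 * tau 5 d * ((D : ℝ) * p * k) :=
          mul_nonneg (mul_nonneg (pow_nonneg hα0 _) (tau_nonneg' _ _)) hR0.le
        calc CA * alpha D ^ 50 * tau 5 d * ((D : ℝ) * p * k)
            = CA * (alpha D ^ 50 * tau 5 d * ((D : ℝ) * p * k)) := by ring
          _ ≤ |CA| * (alpha D ^ 50 * tau 5 d * ((D : ℝ) * p * k)) :=
              mul_le_mul_of_nonneg_right (le_abs_self _) h0
          _ = _ := by ring
      have hgt : ‖gtilde3 c' D ((d * k : ℕ) : ℝ) / (d : ℂ)‖ ≤ 1 / d := by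
        rw [norm_div, Complex.norm_natCast]
        exact div_le_div_of_nonneg_right (norm_gtilde3_le c' hℓ0 (d * k)) (Nat.cast_nonneg d)
      calc ‖gtilde3 c' D ((d * k : ℕ) : ℝ) / (d : ℂ)‖ * ‖L d - main d‖
          ≤ (1 / d) * (|CA| * alpha D ^ 50 * tau 5 d * ((D : ℝ) * p * k)) :=
            mul_le_mul hgt h23' (norm_nonneg _) (by positivity)
        _ = |CA| * alpha D ^ 50 * ((D : ℝ) * p * k) * (tau 5 d / d) := by ring
    · rw [not_lt] at hdk
      rw [gtilde3_eq_zero_of_le c' (Nat.mul_pos hd0 hk) hdk, zero_div, norm_zero, zero_mul]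
      exact hrhs0
  -- Step 3: summing
  have hQP : (Q : ℝ) ≤ bigP D := (Nat.floor_le (by positivity)).trans (hDP D hDP')
  have hlogQ : (1 + Real.log Q) ^ 5 ≤ 32 * ell D ^ 45 := by
    have hQ1 : Real.log Q ≤ ell D ^ 9 := by
      rcases Nat.eq_zero_or_pos Q with h0 | hQ0
      · rw [h0, Nat.cast_zero, Real.log_zero]; positivity
      · calc Real.log Q ≤ Real.log (bigP D) := Real.log_le_log (by exact_mod_cast hQ0) hQP
          _ = ell D ^ 9 := by rw [bigP, Real.log_exp]
    have h19 : 1 ≤ ell D ^ 9 := one_le_pow₀ hℓ1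
    have hlog0 : 0 ≤ Real.log Q := Real.log_natCast_nonneg Q
    calc (1 + Real.log Q) ^ 5 ≤ (2 * ell D ^ 9) ^ 5 :=
          pow_le_pow_left₀ (by linarith) (by linarith) 5
      _ = 32 * ell D ^ 45 := by ring
  have hα20 : alpha D ^ 20 * ell D ^ 45 ≤ Real.pi ^ 20 := by
    have hα : alpha D = Real.pi / ell D ^ 9 := by rw [alpha, bigP, Real.log_exp]
    rw [hα, div_pow, ← pow_mul, div_mul_eq_mul_div, div_le_iff₀ (by positivity)]
    have : ell D ^ 45 ≤ ell D ^ (9 * 20) := pow_le_pow_right₀ hℓ1 (by norm_num)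
    exact mul_le_mul_of_nonneg_left this (by positivity)
  have hK0 : 0 ≤ |CA| * alpha D ^ 50 * ((D : ℝ) * p * k) :=
    mul_nonneg (mul_nonneg (abs_nonneg _) (pow_nonneg hα0 _)) hR0.le
  calc ‖∑ d ∈ Finset.Icc 1 Q, (gtilde3 c' D ((d * k : ℕ) : ℝ) / (d : ℂ) * L d -
          gtilde3 c' D ((d * k : ℕ) : ℝ) / (d : ℂ) * main d)‖
      ≤ ∑ d ∈ Finset.Icc 1 Q, ‖gtilde3 c' D ((d * k : ℕ) : ℝ) / (d : ℂ) * L d -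
          gtilde3 c' D ((d * k : ℕ) : ℝ) / (d : ℂ) * main d‖ := norm_sum_le _ _
    _ ≤ ∑ d ∈ Finset.Icc 1 Q, |CA| * alpha D ^ 50 * ((D : ℝ) * p * k) * (tau 5 d / d) := Finset.sum_le_sum hterm
    _ = |CA| * alpha D ^ 50 * ((D : ℝ) * p * k) * ∑ d ∈ Finset.Icc 1 Q, tau 5 d / d := by
        rw [Finset.mul_sum]
    _ ≤ |CA| * alpha D ^ 50 * ((D : ℝ) * p * k) * (1 + Real.log Q) ^ 5 :=
        mul_le_mul_of_nonneg_left (MeanSquareMajorant.sum_tau_div_Icc_le_log_pow 5 Q) hK0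
    _ ≤ |CA| * alpha D ^ 50 * ((D : ℝ) * p * k) * (32 * ell D ^ 45) :=
        mul_le_mul_of_nonneg_left hlogQ hK0
    _ = 32 * |CA| * (alpha D ^ 20 * ell D ^ 45) * alpha D ^ 30 * ((D : ℝ) * p * k) := by ring
    _ ≤ 32 * |CA| * Real.pi ^ 20 * alpha D ^ 30 * ((D : ℝ) * p * k) := by
        have h1 : 0 ≤ 32 * |CA| := mul_nonneg (by norm_num) (abs_nonneg _)
        exact mul_le_mul_of_nonneg_right (mul_le_mul_of_nonneg_right
          (mul_le_mul_of_nonneg_left hα20 h1) (pow_nonneg hα0 _)) hR0.le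
    _ = 32 * Real.pi ^ 20 * |CA| * alpha D ^ 30 * ((D : ℝ) * p * k) := by ring


/-! ## (15.11) from u024 -/

/-- For every real `M`, `M ≤ 𝓛` for all large `D` (local copy). [cite: Zhang2022LandauSiegel, §2 (2.1)] -/
private theorem exists_nat_forall_le_ell_e (M : ℝ) : ∃ D₀ : ℕ, ∀ D : ℕ, D₀ ≤ D → M ≤ ell D := by
  refine ⟨⌈Real.exp M⌉₊ + 1, fun D hD => ?_⟩
  have h1 : Real.exp M ≤ D := by
    have : (⌈Real.exp M⌉₊ : ℝ) + 1 ≤ D := by exact_mod_cast hD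
    linarith [Nat.le_ceil (Real.exp M)]
  have hD0 : (0 : ℝ) < D := lt_of_lt_of_le (Real.exp_pos M) h1
  rw [ell, Real.le_log_iff_exp_le hD0]
  exact h1

/-- The rearrangement behind "rewriting `d`, `l` and `m` for `d₂`, `l₂` and `d₁`" (p. 83, tex L4154):
`Σ_k A(k) Σ_{d₁,d₂} B(k,d₁,d₂) Σ_{(l,k)=1} E(d₂,l) = Σ_{d₂,l} E(d₂,l) Σ_{(k,l)=1} A(k) Σ_{d₁} B(k,d₁,d₂)`
(finite sums). [folklore] -/
private theorem sum_rearrange_1511 (Sk Sd Sl : Finset ℕ) (A : ℕ → ℂ) (B : ℕ → ℕ → ℕ → ℂ)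
    (E : ℕ → ℕ → ℂ) :
    ∑ k ∈ Sk, A k * ∑ d₁ ∈ Sd, ∑ d₂ ∈ Sd, B k d₁ d₂ *
        ∑ l ∈ Sl, (if Nat.Coprime l k then E d₂ l else 0) =
      ∑ d₂ ∈ Sd, ∑ l ∈ Sl, E d₂ l *
        ∑ k ∈ Sk, (if Nat.Coprime l k then A k * ∑ d₁ ∈ Sd, B k d₁ d₂ else 0) := by
  classical
  -- both sides as a quadruple sum of `T k d₁ d₂ l`
  set T : ℕ → ℕ → ℕ → ℕ → ℂ := fun k d₁ d₂ l =>
    if Nat.Coprime l k then A k * B k d₁ d₂ * E d₂ l else 0 with hT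
  have hL : ∑ k ∈ Sk, A k * ∑ d₁ ∈ Sd, ∑ d₂ ∈ Sd, B k d₁ d₂ *
        ∑ l ∈ Sl, (if Nat.Coprime l k then E d₂ l else 0) =
      ∑ k ∈ Sk, ∑ d₁ ∈ Sd, ∑ d₂ ∈ Sd, ∑ l ∈ Sl, T k d₁ d₂ l := by
    refine Finset.sum_congr rfl fun k _ => ?_
    rw [Finset.mul_sum]
    refine Finset.sum_congr rfl fun d₁ _ => ?_
    rw [Finset.mul_sum]
    refine Finset.sum_congr rfl fun d₂ _ => ?_
    rw [Finset.mul_sum, Finset.mul_sum]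
    refine Finset.sum_congr rfl fun l _ => ?_
    simp only [hT]
    split_ifs <;> ring
  have hR : ∑ d₂ ∈ Sd, ∑ l ∈ Sl, E d₂ l *
        ∑ k ∈ Sk, (if Nat.Coprime l k then A k * ∑ d₁ ∈ Sd, B k d₁ d₂ else 0) =
      ∑ d₂ ∈ Sd, ∑ l ∈ Sl, ∑ k ∈ Sk, ∑ d₁ ∈ Sd, T k d₁ d₂ l := by
    refine Finset.sum_congr rfl fun d₂ _ => Finset.sum_congr rfl fun l _ => ?_
    rw [Finset.mul_sum]
    refine Finset.sum_congr rfl fun k _ => ?_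
    simp only [hT]
    split_ifs
    · rw [Finset.mul_sum, Finset.mul_sum]
      refine Finset.sum_congr rfl fun d₁ _ => ?_
      ring
    · simp
  rw [hL, hR]
  -- reorder `Σ_{d₂} Σ_l Σ_k Σ_{d₁}` into `Σ_k Σ_{d₁} Σ_{d₂} Σ_l`
  calc ∑ k ∈ Sk, ∑ d₁ ∈ Sd, ∑ d₂ ∈ Sd, ∑ l ∈ Sl, T k d₁ d₂ l
      = ∑ k ∈ Sk, ∑ d₂ ∈ Sd, ∑ d₁ ∈ Sd, ∑ l ∈ Sl, T k d₁ d₂ l :=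
        Finset.sum_congr rfl fun k _ => Finset.sum_comm
    _ = ∑ k ∈ Sk, ∑ d₂ ∈ Sd, ∑ l ∈ Sl, ∑ d₁ ∈ Sd, T k d₁ d₂ l :=
        Finset.sum_congr rfl fun k _ => Finset.sum_congr rfl fun d₂ _ => Finset.sum_comm
    _ = ∑ d₂ ∈ Sd, ∑ k ∈ Sk, ∑ l ∈ Sl, ∑ d₁ ∈ Sd, T k d₁ d₂ l := Finset.sum_comm
    _ = ∑ d₂ ∈ Sd, ∑ l ∈ Sl, ∑ k ∈ Sk, ∑ d₁ ∈ Sd, T k d₁ d₂ l :=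
        Finset.sum_congr rfl fun d₂ _ => Finset.sum_comm

/-- `|μ(k)| ≤ 1` in `ℂ`. [folklore] -/
private theorem norm_moebius_le_one (k : ℕ) : ‖(ArithmeticFunction.moebius k : ℂ)‖ ≤ 1 := by
  rw [Complex.norm_intCast]
  exact_mod_cast ArithmeticFunction.abs_moebius_le_one

/-- The scalar bookkeeping `φ(D)⁻¹·(μχ(k)/(kφ(k)))·𝓡·Dpk·V = (𝓡Dp/φ(D))·(μχ(k)/φ(k))·V`. [folklore] -/
private theorem weight_cancel (φD μχ R D' p k φk V : ℂ) (hk : k ≠ 0) (hφk : φk ≠ 0) (hφD : φD ≠ 0) :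
    φD⁻¹ * (μχ / (k * φk) * (R * (D' * p * k) * V)) = R * D' * p / φD * (μχ / φk * V) := by
  field_simp

/-- The `k`-th weighted error of (15.7): `‖μχ(k)/(kφ(k)) · X‖ ≤ M/φ(k)` when `‖X‖ ≤ M·k`.
[cite: Zhang2022LandauSiegel, §15 (15.7) p. 82] -/
private theorem norm_weight_mul_le {D : ℕ} (χ : DirichletCharacter ℂ D) {k : ℕ} (hk : 0 < k)
    {X : ℂ} {M : ℝ} (hX : ‖X‖ ≤ M * k) :
    ‖(ArithmeticFunction.moebius k : ℂ) * χ (k : ZMod D) / ((k : ℂ) * (Nat.totient k : ℂ)) * X‖ ≤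
      M * (1 / (Nat.totient k : ℝ)) := by
  have hk0 : (0 : ℝ) < k := by exact_mod_cast hk
  have hφ0 : (0 : ℝ) < Nat.totient k := by exact_mod_cast Nat.totient_pos.mpr hk
  have hw : ‖(ArithmeticFunction.moebius k : ℂ) * χ (k : ZMod D) / ((k : ℂ) * (Nat.totient k : ℂ))‖ ≤
      1 / ((k : ℝ) * Nat.totient k) := by
    rw [norm_div, norm_mul, norm_mul, Complex.norm_natCast, Complex.norm_natCast]
    refine div_le_div_of_nonneg_right ?_ (by positivity)
    calc ‖(ArithmeticFunction.moebius k : ℂ)‖ * ‖χ (k : ZMod D)‖ ≤ 1 * 1 :=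
          mul_le_mul (norm_moebius_le_one k) (DirichletCharacter.norm_le_one _ _) (norm_nonneg _)
            zero_le_one
      _ = 1 := one_mul _
  rw [norm_mul]
  calc ‖(ArithmeticFunction.moebius k : ℂ) * χ (k : ZMod D) / ((k : ℂ) * (Nat.totient k : ℂ))‖ * ‖X‖
      ≤ (1 / ((k : ℝ) * Nat.totient k)) * (M * k) := mul_le_mul hw hX (norm_nonneg _) (by positivity)
    _ = M * (1 / (Nat.totient k : ℝ)) := by field_simp

/-- **(15.11) at `b = χ·b` from u024** (p. 83, tex L4154: "Inserting this into (15.7) and rewriting `d`, `l`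
and `m` for `d₂`, `l₂` and `d₁` respectively, we obtain (15.11)"): the typed node
`Typed.Section15A.Eq15_11 c′ bChi` from `Step15_u024 c′ bChi`. Route: (15.7) is the definition of
`Phi1pOf`; inserting u024 for every `k ≤ 2P₄` leaves the error `φ(D)⁻¹Σ_k |μχ(k)|/(kφ(k))·Cα³⁰Dpk ≤
Cα³⁰p(D/φ(D))Σ_{k≤2P₄}φ(k)⁻¹ ≤ Cα³⁰·2P·2log𝓛·(7+12𝓛⁹) = o(P)` (`Ded1524.self_div_totient_le_two_mul_loglog`,
`Montgomery.sum_Icc_inv_totient_le`); the main term is re-indexed onto `𝔇₁(d,l)` (`calD1`), the ranges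
`d ≤ 2P₄`, `l ∈ ℕ` versus `d, l ≤ P` agreeing on the support of `b` (`dl < PT⁻²`).
[cite: Zhang2022LandauSiegel, §15 (15.11) p. 83, tex L4154] -/
theorem eq15_11_chi_of_u024 (c' : ℝ) (h24 : Step15_u024 c' bChi) : Eq15_11 c' bChi := by
  intro ε hε
  obtain ⟨C₂₄, D₂₄, h24'⟩ := h24
  obtain ⟨Dφ, hφ⟩ := Ded1524.self_div_totient_le_two_mul_loglog
  obtain ⟨DP, hDP⟩ := Typed.Sec14.exists_two_mul_P4_le_bigP
  obtain ⟨Dε, hDε⟩ := exists_nat_forall_le_ell_e (76 * |C₂₄| * Real.pi ^ 30 / ε + 3)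
  refine ⟨max (max D₂₄ Dφ) (max DP (max Dε ⌈Real.exp 3⌉₊)),
    fun D _ χ hD hq hp hA p hpw => ?_⟩
  have hD₂₄ : D₂₄ ≤ D := le_trans (le_trans (le_max_left _ _) (le_max_left _ _)) hD
  have hDφ : Dφ ≤ D := le_trans (le_trans (le_max_right _ _) (le_max_left _ _)) hD
  have hDP' : DP ≤ D := le_trans (le_trans (le_max_left _ _) (le_max_right _ _)) hD
  have hDε' : Dε ≤ D :=
    le_trans (le_trans (le_trans (le_max_left _ _) (le_max_right _ _)) (le_max_right _ _)) hD
  have hℓ3 : 3 ≤ ell D := three_le_ell_of_le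
    (le_trans (le_trans (le_trans (le_max_right _ _) (le_max_right _ _)) (le_max_right _ _)) hD)
  have hℓ1 : 1 ≤ ell D := by linarith
  have hℓ0 : 0 < ell D := by linarith
  have hD3 : 3 ≤ D := by
    by_contra h
    have : (D : ℝ) < 3 := by exact_mod_cast (not_le.mp h)
    have hD0 : (0 : ℝ) ≤ D := Nat.cast_nonneg D
    have : ell D < 3 := by
      rcases eq_or_lt_of_le hD0 with h0 | h0
      · rw [ell, ← h0, Real.log_zero]; norm_num
      · calc ell D = Real.log D := rfl
          _ < Real.log 3 := Real.log_lt_log h0 this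
          _ ≤ 3 := by
              have := Real.log_le_sub_one_of_pos (show (0:ℝ) < 3 by norm_num); linarith
    linarith
  obtain ⟨hα0, -, hαπ⟩ := alpha_facts hD3
  have hp0 : 0 < p := (Finset.mem_filter.mp hpw).2.pos
  have hD0 : 0 < D := by omega
  have hφD : 0 < (Nat.totient D : ℝ) := by exact_mod_cast Nat.totient_pos.mpr hD0
  have h24D := h24' D χ hD₂₄ hq hp hA p hpw
  set Q : ℕ := ⌊2 * P4 D⌋₊ with hQdef
  set NP : ℕ := ⌊bigP D⌋₊ with hNPdef
  have hP4 : 0 < P4 D := by rw [P4, bigP, bigT, t0]; positivity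
  have hP0 : 0 < bigP D := by rw [bigP]; positivity
  have hQP : 2 * P4 D ≤ bigP D := hDP D hDP'
  have hQNP : Q ≤ NP := Nat.floor_le_floor hQP
  have hPT2 : bigP D / bigT D ^ 2 ≤ 2 * P4 D := by
    rw [P4]
    have ht0 : 1 ≤ t0 D := one_le_pow₀ hℓ1
    have hT0 : 0 < bigT D ^ 2 := by rw [bigT]; positivity
    have : bigP D / bigT D ^ 2 * 1 ≤ bigP D / bigT D ^ 2 * t0 D :=
      mul_le_mul_of_nonneg_left ht0 (by positivity)
    linarith [div_nonneg hP0.le hT0.le]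
  -- sizes
  have hp2P : (p : ℝ) ≤ 2 * bigP D := by
    have h1 : (p : ℝ) < bigP D * (1 + (ell D ^ 68)⁻¹) :=
      Nat.lt_ceil.mp (Finset.mem_Ioo.mp (Finset.mem_filter.mp hpw).1).2
    have h2 : (ell D ^ 68)⁻¹ ≤ 1 := inv_le_one_of_one_le₀ (one_le_pow₀ hℓ1)
    nlinarith
  have hDφ' : (D : ℝ) / Nat.totient D ≤ 2 * ell D := by
    refine (hφ D hDφ).trans ?_
    have : Real.log (ell D) ≤ ell D := (Real.log_le_sub_one_of_pos hℓ0).trans (by linarith)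
    linarith
  have hsumφ : ∑ k ∈ Finset.Icc 1 Q, 1 / (Nat.totient k : ℝ) ≤ 19 * ell D ^ 9 := by
    refine (Montgomery.sum_Icc_inv_totient_le Q).trans ?_
    have hlogQ : Real.log Q ≤ ell D ^ 9 := by
      rcases Nat.eq_zero_or_pos Q with h0 | hQ0
      · rw [h0, Nat.cast_zero, Real.log_zero]; positivity
      · have hQP' : (Q : ℝ) ≤ bigP D := (Nat.floor_le (mul_nonneg zero_le_two hP4.le)).trans hQP
        calc Real.log Q ≤ Real.log (bigP D) := Real.log_le_log (by exact_mod_cast hQ0) hQP'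
          _ = ell D ^ 9 := by rw [bigP, Real.log_exp]
    have h19 : 1 ≤ ell D ^ 9 := one_le_pow₀ hℓ1
    calc 7 + 12 * Real.log Q ≤ 7 * ell D ^ 9 + 12 * ell D ^ 9 :=
          add_le_add (by nlinarith) (mul_le_mul_of_nonneg_left hlogQ (by norm_num))
      _ = 19 * ell D ^ 9 := by ring
  have hK : 76 * |C₂₄| * Real.pi ^ 30 / ε + 3 ≤ ell D := hDε D hDε'
  -- support facts for `χ·b`
  have hsupp_l : ∀ (d l : ℕ), 0 < d → l ∉ Finset.Icc 1 NP → bChi D χ (d * l) = 0 := by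
    intro d l hd hl
    rw [Finset.mem_Icc, not_and_or, not_le, not_le] at hl
    rcases hl with h0 | hN'
    · have : l = 0 := by omega
      subst this; simp [bChi, bchi, bcoef]
    · refine bChi_eq_zero_of_le χ hℓ3 ?_
      have h1 : bigP D < l := (Nat.floor_lt hP0.le).mp hN'
      have h2 : (l : ℝ) ≤ ((d * l : ℕ) : ℝ) := by exact_mod_cast Nat.le_mul_of_pos_left l hd
      have h3 : bigP D / bigT D ^ 2 ≤ bigP D := by
        refine div_le_self hP0.le (one_le_pow₀ ?_)
        rw [bigT]; exact Real.one_le_exp (by positivity)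
      linarith
  have hsupp_d : ∀ (d l : ℕ), d ∈ Finset.Icc 1 NP → d ∉ Finset.Icc 1 Q → 0 < l →
      bChi D χ (d * l) = 0 := by
    intro d l hd hdQ hl
    rw [Finset.mem_Icc] at hd
    rw [Finset.mem_Icc, not_and_or, not_le, not_le] at hdQ
    rcases hdQ with h0 | hQ'
    · omega
    · refine bChi_eq_zero_of_le χ hℓ3 ?_
      have h1 : 2 * P4 D < d := (Nat.floor_lt (by positivity)).mp hQ'
      have h2 : (d : ℝ) ≤ ((d * l : ℕ) : ℝ) := by exact_mod_cast Nat.le_mul_of_pos_right d hl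
      linarith
  -- the pieces of (15.7) and of u024
  set w : ℕ → ℂ := fun k =>
    (ArithmeticFunction.moebius k : ℂ) * χ (k : ZMod D) / ((k : ℂ) * (Nat.totient k : ℂ)) with hw
  set U : ℕ → ℂ := fun k => ∑ d ∈ Finset.Icc 1 Q, gtilde3 c' D ((d * k : ℕ) : ℝ) / (d : ℂ) *
      ∑' l : ℕ, if Nat.Coprime l k then
        kappaStar1 c' D (bChi D χ) (d * l) * χ (l : ZMod D) * DeltaW D ((l : ℝ) / ((D : ℝ) * p * k))
      else 0 with hU
  set G : ℕ → ℕ → ℂ := fun k d₂ => ∑' l₂ : ℕ, (if Nat.Coprime l₂ k then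
      bChi D χ (d₂ * l₂) * χ (l₂ : ZMod D) / (l₂ : ℂ) else 0) with hG
  set V : ℕ → ℂ := fun k => ∑ d₁ ∈ Finset.Icc 1 Q, ∑ d₂ ∈ Finset.Icc 1 Q,
      gtilde3 c' D ((d₁ * d₂ * k : ℕ) : ℝ) / ((d₁ : ℂ) * d₂) *
        kappaTilde1 c' χ d₁ (d₂ * k) 1 * lam1 c' χ (d₁ * d₂ * k) 1 * G k d₂ with hV
  -- (15.7): `Φ₁(p) = φ(D)⁻¹ Σ_k w(k) U(k)`
  have hPhi : Phi1pOf c' χ (bChi D χ) p = (Nat.totient D : ℂ)⁻¹ * ∑ k ∈ Finset.Icc 1 Q, w k * U k := by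
    simp only [Phi1pOf, hw, hU, hQdef]
  -- the `G`'s as finite sums
  have hGfin : ∀ k d₂ : ℕ, 0 < d₂ → G k d₂ = ∑ l ∈ Finset.Icc 1 NP,
      (if Nat.Coprime l k then bChi D χ (d₂ * l) * χ (l : ZMod D) / (l : ℂ) else 0) := by
    intro k d₂ hd₂
    refine tsum_eq_sum fun l hl => ?_
    rw [hsupp_l d₂ l hd₂ hl]; simp
  -- the rearranged main term, for one `k`
  set A : ℕ → ℂ := fun k => (ArithmeticFunction.moebius k : ℂ) * χ (k : ZMod D) / (Nat.totient k : ℂ)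
    with hAdef
  set B : ℕ → ℕ → ℕ → ℂ := fun k d₁ d₂ =>
    kappaTilde1 c' χ d₁ (d₂ * k) 1 * lam1 c' χ (d₁ * d₂ * k) 1 *
      gtilde3 c' D ((d₁ * d₂ * k : ℕ) : ℝ) / (d₁ : ℂ) with hBdef
  set E : ℕ → ℕ → ℂ := fun d₂ l => bChi D χ (d₂ * l) * χ (l : ZMod D) / ((d₂ : ℂ) * l) with hEdef
  have hVfin : ∀ k : ℕ, V k = ∑ d₁ ∈ Finset.Icc 1 Q, ∑ d₂ ∈ Finset.Icc 1 Q,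
      gtilde3 c' D ((d₁ * d₂ * k : ℕ) : ℝ) / ((d₁ : ℂ) * d₂) *
        kappaTilde1 c' χ d₁ (d₂ * k) 1 * lam1 c' χ (d₁ * d₂ * k) 1 *
          ∑ l ∈ Finset.Icc 1 NP,
            (if Nat.Coprime l k then bChi D χ (d₂ * l) * χ (l : ZMod D) / (l : ℂ) else 0) := by
    intro k
    simp only [hV]
    refine Finset.sum_congr rfl fun d₁ _ => Finset.sum_congr rfl fun d₂ hd₂ => ?_
    rw [hGfin k d₂ (Finset.mem_Icc.mp hd₂).1]
  have hk_term : ∀ k ∈ Finset.Icc 1 Q,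
      (Nat.totient D : ℂ)⁻¹ * (w k * (calR1star c' χ * ((D : ℂ) * p * k) * V k)) =
        calR1star c' χ * (D : ℂ) * p / (Nat.totient D : ℂ) *
          (A k * ∑ d₁ ∈ Finset.Icc 1 Q, ∑ d₂ ∈ Finset.Icc 1 Q, B k d₁ d₂ *
            ∑ l ∈ Finset.Icc 1 NP, (if Nat.Coprime l k then E d₂ l else 0)) := by
    intro k hk
    have hk0 : (k : ℂ) ≠ 0 := by
      have : 0 < k := (Finset.mem_Icc.mp hk).1; exact_mod_cast this.ne'
    have hφ0 : (Nat.totient D : ℂ) ≠ 0 := by exact_mod_cast (Nat.totient_pos.mpr hD0).ne'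
    have hφk0 : (Nat.totient k : ℂ) ≠ 0 := by
      exact_mod_cast (Nat.totient_pos.mpr (Finset.mem_Icc.mp hk).1).ne'
    have hwA : (Nat.totient D : ℂ)⁻¹ * (w k * (calR1star c' χ * ((D : ℂ) * p * k) * V k)) =
        calR1star c' χ * (D : ℂ) * p / (Nat.totient D : ℂ) * (A k * V k) := by
      simp only [hw, hAdef]
      exact weight_cancel _ _ _ _ _ _ _ _ hk0 hφk0 hφ0
    rw [hwA, hVfin k]
    congr 1
    congr 1
    refine Finset.sum_congr rfl fun d₁ _ => Finset.sum_congr rfl fun d₂ _ => ?_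
    simp only [hBdef, hEdef]
    rw [Finset.mul_sum, Finset.mul_sum]
    refine Finset.sum_congr rfl fun l _ => ?_
    split_ifs
    · ring
    · simp
  -- the main term of (15.11) equals `φ(D)⁻¹ Σ_k w(k)·𝓡₁*Dpk·V(k)`
  have hMain : calR1star c' χ * (D : ℂ) * p / (Nat.totient D : ℂ) *
        ∑ d ∈ Finset.Icc 1 ⌊bigP D⌋₊, ∑ l ∈ Finset.Icc 1 ⌊bigP D⌋₊,
          bChi D χ (d * l) * χ (l : ZMod D) / ((d : ℂ) * l) * calD1 c' χ d l =
      (Nat.totient D : ℂ)⁻¹ * ∑ k ∈ Finset.Icc 1 Q, w k * (calR1star c' χ * ((D : ℂ) * p * k) * V k) := by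
    symm
    calc (Nat.totient D : ℂ)⁻¹ * ∑ k ∈ Finset.Icc 1 Q, w k * (calR1star c' χ * ((D : ℂ) * p * k) * V k)
        = ∑ k ∈ Finset.Icc 1 Q,
            (Nat.totient D : ℂ)⁻¹ * (w k * (calR1star c' χ * ((D : ℂ) * p * k) * V k)) :=
          Finset.mul_sum _ _ _
      _ = ∑ k ∈ Finset.Icc 1 Q, calR1star c' χ * (D : ℂ) * p / (Nat.totient D : ℂ) *
            (A k * ∑ d₁ ∈ Finset.Icc 1 Q, ∑ d₂ ∈ Finset.Icc 1 Q, B k d₁ d₂ *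
              ∑ l ∈ Finset.Icc 1 NP, (if Nat.Coprime l k then E d₂ l else 0)) :=
          Finset.sum_congr rfl hk_term
      _ = calR1star c' χ * (D : ℂ) * p / (Nat.totient D : ℂ) *
            ∑ k ∈ Finset.Icc 1 Q, A k * ∑ d₁ ∈ Finset.Icc 1 Q, ∑ d₂ ∈ Finset.Icc 1 Q, B k d₁ d₂ *
              ∑ l ∈ Finset.Icc 1 NP, (if Nat.Coprime l k then E d₂ l else 0) := by
          rw [← Finset.mul_sum]
      _ = calR1star c' χ * (D : ℂ) * p / (Nat.totient D : ℂ) *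
            ∑ d₂ ∈ Finset.Icc 1 Q, ∑ l ∈ Finset.Icc 1 NP, E d₂ l *
              ∑ k ∈ Finset.Icc 1 Q, (if Nat.Coprime l k then
                A k * ∑ d₁ ∈ Finset.Icc 1 Q, B k d₁ d₂ else 0) := by
          rw [sum_rearrange_1511]
      _ = calR1star c' χ * (D : ℂ) * p / (Nat.totient D : ℂ) *
            ∑ d₂ ∈ Finset.Icc 1 Q, ∑ l ∈ Finset.Icc 1 NP, E d₂ l * calD1 c' χ d₂ l := by
          congr 1
          refine Finset.sum_congr rfl fun d hd => Finset.sum_congr rfl fun l hl => ?_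
          congr 1
          rw [calD1, Finset.sum_filter]
          refine Finset.sum_congr rfl fun k hk => ?_
          simp only [Nat.coprime_comm (m := k), hAdef, hBdef]
          split_ifs
          · rw [Finset.mul_sum]
          · rfl
      _ = calR1star c' χ * (D : ℂ) * p / (Nat.totient D : ℂ) *
            ∑ d ∈ Finset.Icc 1 ⌊bigP D⌋₊, ∑ l ∈ Finset.Icc 1 ⌊bigP D⌋₊,
              bChi D χ (d * l) * χ (l : ZMod D) / ((d : ℂ) * l) * calD1 c' χ d l := by
          congr 1
          rw [← hNPdef]
          refine Finset.sum_subset (Finset.Icc_subset_Icc_right hQNP) ?_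
          intro d hd hdQ
          refine Finset.sum_eq_zero fun l hl => ?_
          simp only [hEdef]
          rw [hsupp_d d l hd hdQ (Finset.mem_Icc.mp hl).1]; simp
  -- the difference and its bound
  rw [hPhi, hMain, ← mul_sub, ← Finset.sum_sub_distrib]
  have hterm : ∀ k ∈ Finset.Icc 1 Q,
      ‖w k * U k - w k * (calR1star c' χ * ((D : ℂ) * p * k) * V k)‖ ≤
        |C₂₄| * alpha D ^ 30 * ((D : ℝ) * p) * (1 / (Nat.totient k : ℝ)) := by
    intro k hk
    have hk1 : 0 < k := (Finset.mem_Icc.mp hk).1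
    have hUk : ‖U k - calR1star c' χ * ((D : ℂ) * p * k) * V k‖ ≤
        |C₂₄| * alpha D ^ 30 * ((D : ℝ) * p) * k := by
      have h := h24D k hk1
      have h' : ‖U k - calR1star c' χ * ((D : ℂ) * p * k) * V k‖ ≤
          C₂₄ * alpha D ^ 30 * ((D : ℝ) * p * k) := by simpa only [hU, hV, hG, hQdef] using h
      refine h'.trans ?_
      have h0 : 0 ≤ alpha D ^ 30 * ((D : ℝ) * p * k) :=
        mul_nonneg (pow_nonneg hα0 _) (mul_nonneg (mul_nonneg (Nat.cast_nonneg _) (Nat.cast_nonneg _))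
          (Nat.cast_nonneg _))
      calc C₂₄ * alpha D ^ 30 * ((D : ℝ) * p * k) = C₂₄ * (alpha D ^ 30 * ((D : ℝ) * p * k)) := by ring
        _ ≤ |C₂₄| * (alpha D ^ 30 * ((D : ℝ) * p * k)) := mul_le_mul_of_nonneg_right (le_abs_self _) h0
        _ = |C₂₄| * alpha D ^ 30 * ((D : ℝ) * p) * k := by ring
    have hfin := norm_weight_mul_le χ hk1 hUk
    rw [← mul_sub, hw]
    exact hfin
  -- assembling
  calc ‖(Nat.totient D : ℂ)⁻¹ * ∑ k ∈ Finset.Icc 1 Q,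
          (w k * U k - w k * (calR1star c' χ * ((D : ℂ) * p * k) * V k))‖
      ≤ (Nat.totient D : ℝ)⁻¹ * ∑ k ∈ Finset.Icc 1 Q,
          ‖w k * U k - w k * (calR1star c' χ * ((D : ℂ) * p * k) * V k)‖ := by
        rw [norm_mul, norm_inv, Complex.norm_natCast]
        exact mul_le_mul_of_nonneg_left (norm_sum_le _ _) (inv_nonneg.mpr hφD.le)
    _ ≤ (Nat.totient D : ℝ)⁻¹ * ∑ k ∈ Finset.Icc 1 Q,
          |C₂₄| * alpha D ^ 30 * ((D : ℝ) * p) * (1 / (Nat.totient k : ℝ)) :=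
        mul_le_mul_of_nonneg_left (Finset.sum_le_sum hterm) (inv_nonneg.mpr hφD.le)
    _ = (Nat.totient D : ℝ)⁻¹ * (|C₂₄| * alpha D ^ 30 * ((D : ℝ) * p) *
          ∑ k ∈ Finset.Icc 1 Q, 1 / (Nat.totient k : ℝ)) := by
        congr 1
        exact (Finset.mul_sum _ _ _).symm
    _ = |C₂₄| * alpha D ^ 30 * p * ((D : ℝ) / Nat.totient D) *
          ∑ k ∈ Finset.Icc 1 Q, 1 / (Nat.totient k : ℝ) := by
        ring
    _ ≤ |C₂₄| * alpha D ^ 30 * (2 * bigP D) * (2 * ell D) * (19 * ell D ^ 9) := by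
        have h1 : 0 ≤ |C₂₄| * alpha D ^ 30 := mul_nonneg (abs_nonneg _) (pow_nonneg hα0 _)
        have h2 : 0 ≤ ∑ k ∈ Finset.Icc 1 Q, 1 / (Nat.totient k : ℝ) :=
          Finset.sum_nonneg fun k _ => div_nonneg zero_le_one (Nat.cast_nonneg _)
        have h3 : 0 ≤ (D : ℝ) / Nat.totient D := div_nonneg (Nat.cast_nonneg _) (Nat.cast_nonneg _)
        have h1' : 0 ≤ |C₂₄| * alpha D ^ 30 * (2 * bigP D) :=
          mul_nonneg h1 (mul_nonneg zero_le_two hP0.le)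
        have h1'' : 0 ≤ |C₂₄| * alpha D ^ 30 * (2 * bigP D) * (2 * ell D) :=
          mul_nonneg h1' (mul_nonneg zero_le_two hℓ0.le)
        calc |C₂₄| * alpha D ^ 30 * p * ((D : ℝ) / Nat.totient D) *
              ∑ k ∈ Finset.Icc 1 Q, 1 / (Nat.totient k : ℝ)
            ≤ |C₂₄| * alpha D ^ 30 * (2 * bigP D) * ((D : ℝ) / Nat.totient D) *
              ∑ k ∈ Finset.Icc 1 Q, 1 / (Nat.totient k : ℝ) :=
                mul_le_mul_of_nonneg_right (mul_le_mul_of_nonneg_right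
                  (mul_le_mul_of_nonneg_left hp2P h1) h3) h2
          _ ≤ |C₂₄| * alpha D ^ 30 * (2 * bigP D) * (2 * ell D) *
              ∑ k ∈ Finset.Icc 1 Q, 1 / (Nat.totient k : ℝ) :=
                mul_le_mul_of_nonneg_right (mul_le_mul_of_nonneg_left hDφ' h1') h2
          _ ≤ |C₂₄| * alpha D ^ 30 * (2 * bigP D) * (2 * ell D) * (19 * ell D ^ 9) :=
                mul_le_mul_of_nonneg_left hsumφ h1''
    _ = 76 * |C₂₄| * (alpha D ^ 30 * ell D ^ 10) * bigP D := by ring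
    _ ≤ ε * bigP D := by
        refine mul_le_mul_of_nonneg_right ?_ hP0.le
        -- `α³⁰𝓛¹⁰ = π³⁰𝓛⁻²⁶⁰ ≤ π³⁰/𝓛` and `76|C₂₄|π³⁰/𝓛 ≤ ε`
        have hα : alpha D = Real.pi / ell D ^ 9 := by rw [alpha, bigP, Real.log_exp]
        have h30 : alpha D ^ 30 * ell D ^ 10 ≤ Real.pi ^ 30 / ell D := by
          rw [hα, div_pow, ← pow_mul, div_mul_eq_mul_div, div_le_div_iff₀ (pow_pos hℓ0 _) hℓ0]
          have h' : ell D ^ 10 * ell D ≤ ell D ^ (9 * 30) := by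
            rw [← pow_succ]; exact pow_le_pow_right₀ hℓ1 (by norm_num)
          calc Real.pi ^ 30 * ell D ^ 10 * ell D = Real.pi ^ 30 * (ell D ^ 10 * ell D) := by ring
            _ ≤ Real.pi ^ 30 * ell D ^ (9 * 30) :=
                mul_le_mul_of_nonneg_left h' (pow_nonneg Real.pi_pos.le 30)
        have hεK : 76 * |C₂₄| * Real.pi ^ 30 / ell D ≤ ε := by
          rw [div_le_iff₀ hℓ0]
          have h3' : 76 * |C₂₄| * Real.pi ^ 30 / ε ≤ ell D :=
            (le_add_of_nonneg_right (by norm_num : (0:ℝ) ≤ 3)).trans hK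
          rw [div_le_iff₀ hε] at h3'
          exact h3'.trans (le_of_eq (mul_comm _ _))
        calc 76 * |C₂₄| * (alpha D ^ 30 * ell D ^ 10) ≤ 76 * |C₂₄| * (Real.pi ^ 30 / ell D) :=
              mul_le_mul_of_nonneg_left h30 (mul_nonneg (by norm_num) (abs_nonneg _))
          _ = 76 * |C₂₄| * Real.pi ^ 30 / ell D := by ring
          _ ≤ ε := hεK

/-- **(15.11) at `b = χ·b` from u021** (the composite of the three edges of this file; u019 is a theorem
of the tree). [cite: Zhang2022LandauSiegel, §15 (15.11) p. 83] -/
theorem eq15_11_chi_of_u021 (c' : ℝ) (h21 : Step15_u021 c') : Eq15_11 c' bChi :=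
  eq15_11_chi_of_u024 c' (step15_u024_chi_of_u021 c' h21)

end Literature.NumberTheory.LFunctions.Zhang2022.Typed.Section15A
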